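import Summits.QuantumFields.YangMills.Theorems.BalabanUVNodesK0AxComplexGaussianRatioHolo

/-!
# K0 axis — the complex Gaussian ratio AT THE RECORD: the (F-Mhol) face DISCHARGED (the record-weighted precision is POLYNOMIAL in the decoupling parameters) and the two
docking theorems specialised to DEF-1's sockets `chiRem` ∕ `piecesFormC` ∕ `recordSWeight` ∕ `recordFluctRatioC` (✓p824829 `…K0RecordFormatNamesFluctRatioC`)

LANDING NOTE (porter ▶ PTC-1 g4, 2026-08-31; AUTHORSHIP = ◇ lens-1 g13 «cauchy-analytic», HOME file `nodeO-cover/LENS-1g13-ComplexGaussianRatioRecord-v2.lean` sha16 072fd9952cfc8733 · 237 l. · 12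
thm · 0 def (CANDIDATE 5 = CGRS FILE №4 v2, superseding v1 e38fd8d0d249817d whose 7 theorems are its §14–§15 unchanged; the RECORD reading END TO END: `measurable_chiRem`, `abs_chiRem_le_one`,
(F-Mhol) discharged at the record hypothesis-free — `differentiable_piecesFormC_recordSWeight_update` (`recordSWeight` is a polynomial along every coordinate line, pieces s-free), and the two
inputs of ✓`norm_decDiffList_le_exp_of_le_length` on `s ↦ recordFluctRatioC F Mc k K ε₁ T E g s ψ`: `sepHolOff_recordFluctRatioC`, `bddOnPoly_recordFluctRatioC`; §16
`norm_gaussRatioC_sub_one_le_box_of_coercive`, `chiRem_eq_one_of_box` ((F-tail-S) discharged: χ_rem = 1 on the box once √3·r < ε₁), `norm_recordFluctRatioC_sub_one_le`; §17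
★★★`norm_decDiffList_recordFluctRatioC_le` — ✓`norm_decDiffList_le_exp_of_le_length` FIRED on `recordFluctRatioC` at radius `R = 1 + e^{κ₁}`: `‖decDiffList l (s ↦ recordFluctRatioC …) s‖ ≤
e^{η+τ∕4}·e^{−κ₁ d}` modulo EXACTLY the three displayed model inequalities (F-coer), (F-int), (F-im); farm evidence = ◇'s monolith
`nodeO-cover/evidence/LENS-1g13-CGR-TailHoloRecord-monolith-check-v2.lean` d4bc800c1c2dd911 rc 0 · 0 warn · 0 sorry, finals' axioms standard): landed VERBATIM + this paragraph under ◇'s basename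
`…Theorems/BalabanUVNodesK0AxComplexGaussianRatioRecord.lean` (ns `…Theorems.K0AxComplexGaussianRatio`), one import `…K0AxComplexGaussianRatioHolo` (INTENT-83, landed just before), as INTENT-84;
`--supports stmt-QuantumFields-27930 --as helper --cite Balaban1987RG1 --cite Balaban1988RG2Cluster --cite Brydges1986` (NO `--workitem`; kind auto ⇒ proof). ◆ CRIT-1's cut: ◆ CRIT-1 g39 «(1b)
file №4 v1 e38fd8d0d249817d · 117 l. · 7 thm · 0 def → GO VERBATIM behind №3 (same probe; J1′: `measurable_chiRem` (finite ⋂ of open sublevel sets ✓),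
`differentiable_piecesFormC_recordSWeight_update` = (F-Mhol) at the record with NO hypothesis — correct BECAUSE the pieces `T_Y(ψ)` are `s`-free by DESIGN WORD (D3) and `recordSWeight` is a
monomial along each coordinate line — honest: this discharges (F-Mhol) for DEF-1's VOCABULARY, whose bridge to print is (R-b); the two docking theorems display exactly (F-coer)(F-int)(F-im))»
(nodeO STATUS 2026-08-31T15:39:29Z) and «(1) CUT + J-STAMP — file №5 `…Rate-v1.lean` 5fb1e20b74b90c59 · 5 thm → GO VERBATIM behind №4 v1 (equivalently №4 v2 072fd9952cfc8733 = v1's 7 ⊕ these 5 —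
path (α)∕(β) indifferent, same 12 declarations); kernel: chain probe №3 ⊕ №4 v1 ⊕ №5 on the TREE imports + 30 std guards farm rc 0 · 0 err · 0 warn · 0 sorry; J1′:
`integrable_gaussIntC_integrand_of_coercive` dominator `(1+η₁)e^{−(a∕2)Σx²}` ✓ · `norm_gaussRatioC_sub_one_le_box_of_coercive` = №2's box theorem with `PosDef`∕`IsSymm`∕both integrability
hypotheses DISCHARGED from coercivity + measurability via symmetrisation ✓ · `chiRem_eq_one_of_box` = rider v15-R1 made a theorem (`0 ≤ r`, `√3·r < ε₁` ⇒ `χ_rem = 1` on the sup-box) ✓ ·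
`norm_recordFluctRatioC_sub_one_le` displays exactly (F-coer) at `s`, (F-int-small), `E` measurable, `0 ≤ r`, `√3 r < ε₁` · ★★★`norm_decDiffList_recordFluctRatioC_le`:
✓`norm_decDiffList_le_exp_of_le_length` FIRED at `R := 1 + e^{κ₁}` ⇒ `‖decDiffList l (s ↦ recordFluctRatioC …) s‖ ≤ e^{η+τ∕4}·e^{−κ₁ d}` MODULO exactly (F-coer) on `cpoly R'` ∕ (F-int) ∕ (F-im)
`τ` — nothing else; J5′∕(Q-ord): none; SAME-WALL: S; located-A = v13.3's chain (a)–(d) is ONE kernel theorem on DEF-1's `recordFluctRatioC`; located-B UNCHANGED = (F-coer)(F-int)(F-im) in S∕M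
currency + the (R-b) bridge to print's (2.12)–(2.13)∕(1.9) + N8b ⇒ SURVIVES priced» (2026-08-31T15:46:29Z); path (α) = this ONE file (v2, 12 thm) chosen by ▶, author's default ◇ l.5795 (A). HONEST
(porter): calculus∕measurability facts about DEF-1's record vocabulary (`chiRem`, `recordSWeight`, `piecesFormC`, `recordFluctRatioC` — typed ≠ inhabited); the MODEL faces (F-coer)∕(F-int)∕(F-im)
are displayed hypotheses inhabited NOWHERE; the bridge to print's (2.12)–(2.13) is ◆ (R-b) stage 2; nothing of Bałaban asserted, ported, discharged or refuted; `stub_FE`∕`stub_P0C` and ⟨27930⟩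
OPEN; K0⁷ 20541 ∕ K0ᴬ 27238 ∕ K1ᴬ ∕ K3ᴬ OPEN — NOTHING of them proved; NODE O 0∕1; COUNT 8∕28 · K 1∕4 UNMOVED; finite 𝕋⁴ at fixed ε — NOT continuum ∕ OS ∕ Clay; the Yang–Mills mass gap is NOT
proved by any of this.

LENS-1 (ideator 1, g13) companion file №4 to NODE v13.3∕v14–v16 of K0⁷ `Record13SepCoPHInhabited` (⟨27930⟩ `stub_FE`, wall N4-R).  Namespace `…Theorems.K0AxComplexGaussianRatio`
(files №1 A∕B∕C ✓p826763∕p826853∕p826928, №2 `…Tail`, №3 `…Holo`).  WHAT THIS FILE DOES — Mathlib bookkeeping, no mathematics of print asserted: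
* §14 `measurable_chiRem`, `abs_chiRem_le_one` — DEF-1's cut-off `χ_rem ∈ {0,1}` is measurable (an intersection of finitely many open half-spaces of continuous functions) and `|χ_rem| ≤ 1`;
  `differentiable_cubeMonomial_update`, `differentiable_recordSWeight_update`, ★ `differentiable_piecesFormC_recordSWeight_update` — along every coordinate line `t ↦ update s y t` the
  record weight `s^Y` is a polynomial in `t`, hence every entry of the re-weighted precision `piecesFormC F k K T (recordSWeight F Mc k K s) ψ` is ENTIRE in `t`: the model face (F-Mhol)
  of NODE v14 §1 is thereby DISCHARGED for the record-pinned edition, with no hypothesis.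
* §15 ★★ `sepHolOff_recordFluctRatioC`, ★★ `bddOnPoly_recordFluctRatioC` — №3's docking theorems with `χ := chiRem F k K ε₁` (measurability + `0 ≤ χ ≤ 1` discharged here) and
  `M s := piecesFormC F k K T (recordSWeight F Mc k K s) ψ` ((F-Mhol) discharged here): what REMAINS displayed is exactly (F-coer) `a·Σx² ≤ Re quadC (M s) x` on `cpoly R'`, (F-int)
  (`E g s ψ` measurable, holomorphic along coordinate lines on `supp χ_rem`, `Re ≤ η` there) and, for the bound, (F-im) the trace budget `τ` — the S∕M hands' currency ((E3)∕(P5ᶜ),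
  the `𝐏_rec + {…}_rec` letters).  With both, ✓`…K0AxCauchyDecoupling` :207 `norm_decDiffList_le_exp_of_le_length` fires on `s ↦ recordFluctRatioC F Mc k K ε₁ T E g s ψ`.
* §16 `integrable_gaussIntC_integrand_of_coercive`, ★★ `norm_gaussRatioC_sub_one_le_box_of_coercive` (file №2's `|R−1|` box theorem with `PosDef`∕`IsSymm`∕integrability DISCHARGED from coercivity),
  `chiRem_eq_one_of_box` (`χ_rem = 1` on `{|x_i| ≤ r}` once `√3·r < ε₁` — (F-tail-S) DISCHARGED), ★★ `norm_recordFluctRatioC_sub_one_le` (the `|c| = 1` clause of N3 at the record);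
  §17 ★★★ `norm_decDiffList_recordFluctRatioC_le` — END TO END: ✓`norm_decDiffList_le_exp_of_le_length` FIRED on `recordFluctRatioC` at radius `1 + e^{κ₁}`:
  `‖Δ_{y₁}⋯Δ_{y_n} recordFluctRatioC (s)‖ ≤ e^{η+τ∕4}·e^{−κ₁ d}` (`d ≤ n`) modulo EXACTLY (F-coer)(F-int)(F-im).
HONEST: finite-dimensional calculus∕measurability only; `chiRem`, `piecesFormC`, `recordSWeight`, `recordFluctRatioC` are DEF-1's VOCABULARY (their bridge to print's (2.12)–(2.13) is a
docstring intention, ◆ (R-b), to be proved at stage 2); (F-coer)(F-int)(F-im) NOT inhabited; `stub_FE`∕`stub_P0C`∕⟨27930⟩∕K0⁷∕K0ᴬ OPEN; NODE O 0∕1; finite 𝕋⁴ at fixed ε — NOT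
continuum∕OS; **the Yang–Mills mass gap (Clay) is NOT proved here.**  No `sorry`; no new `Prop` letters; no instances∕notation∕attributes.
-/

noncomputable section

open scoped BigOperators Topology
open MeasureTheory Complex Metric Set Function
open Summit.QuantumFields.YangMills.Theorems.K0RecordFormatNames
open Summit.QuantumFields.YangMills.Theorems.K0AxCauchyDecoupling (cpoly SepHolOff BddOnPoly decDiffList norm_decDiffList_le_exp_of_le_length)
open Literature.MathematicalPhysics.QuantumFieldTheory.Balaban1983to89.T4Continuum (T4Family)

namespace Summit.QuantumFields.YangMills.Theorems.K0AxComplexGaussianRatio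

variable (F : T4Family)

/-! ## §14  DEF-1's sockets: measurability of `χ_rem`, polynomiality of the record weights along coordinate lines ((F-Mhol) discharged) -/

/-- `χ_rem` is measurable: `{x | ∀ b ∉ range b₀, √(Σ_a x(b,a)²) < ε₁}` is a finite intersection of sublevel sets of continuous functions. [cite: Balaban1987RG1, (2.9) p.266 (bookkeeping)] -/
theorem measurable_chiRem (k K : ℕ) (ε₁ : ℝ) : Measurable (chiRem F k K ε₁) := by
  classical
  unfold chiRem
  refine Measurable.ite ?_ measurable_const measurable_const
  simp only [Set.setOf_forall]
  exact MeasurableSet.iInter fun b => MeasurableSet.iInter fun hb =>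
    measurableSet_lt (show Continuous fun x : NonB0Idx F k K → ℝ => √(∑ a : Fin 3, x ⟨(b, a), hb⟩ ^ 2) by fun_prop).measurable measurable_const

/-- `|χ_rem| ≤ 1` (from ✓`chiRem_nonneg_le_one`). [cite: Balaban1987RG1, (2.9) p.266 (bookkeeping)] -/
theorem abs_chiRem_le_one (k K : ℕ) (ε₁ : ℝ) (x : NonB0Idx F k K → ℝ) : |chiRem F k K ε₁ x| ≤ 1 := by
  have h := chiRem_nonneg_le_one F k K ε₁ x
  exact abs_le.mpr ⟨by linarith [h.1], h.2⟩

/-- Along a coordinate line the cube monomial `s^Q` is a polynomial in `t`, hence entire. [cite: Balaban1988RG2Cluster, (1.9)–(1.10) p.4 (bookkeeping)] -/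
theorem differentiable_cubeMonomial_update (s : (Fin 4 → ℤ) → ℂ) (y : Fin 4 → ℤ) (Q : Finset (Fin 4 → ℤ)) :
    Differentiable ℂ (fun t : ℂ => cubeMonomial (update s y t) Q) := by
  unfold cubeMonomial
  refine Differentiable.fun_finsetProd fun q _ => ?_
  by_cases h : q = y
  · subst h; simp only [update_self]; exact differentiable_id
  · simp only [update_of_ne h]; exact differentiable_const _

/-- Along a coordinate line the record weight `recordSWeight F Mc k K s Y` (`1` on single-cube pieces, `s^{cubes(Y)}` else) is entire in `t`. [cite: Balaban1988RG2Cluster, (1.9) p.4 (bookkeeping)] -/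
theorem differentiable_recordSWeight_update (Mc k K : ℕ) (s : (Fin 4 → ℤ) → ℂ) (y : Fin 4 → ℤ) (Y : (recordDomSys F Mc k K).Dom) :
    Differentiable ℂ (fun t : ℂ => recordSWeight F Mc k K (update s y t) Y) := by
  by_cases h : (intCubes F Mc k K Y).card ≤ 1
  · simp only [recordSWeight, h, if_true]; exact differentiable_const _
  · simp only [recordSWeight, h, if_false]; exact differentiable_cubeMonomial_update s y _

/-- ★ **(F-Mhol) DISCHARGED at the record**: every entry of the re-weighted precision `piecesFormC F k K T (recordSWeight F Mc k K s) ψ = Σ_Y s^Y·T_Y(ψ)` is ENTIRE along every coordinate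
line of the decoupling parameters (the pieces `T_Y(ψ)` do not depend on `s`; DESIGN WORD (D3)). [cite: Balaban1987RG1, (2.11)–(2.12) pp.267–268; Balaban1988RG2Cluster, (1.9)–(1.10) p.4] -/
theorem differentiable_piecesFormC_recordSWeight_update {Ψ : Type*} (Mc k K : ℕ)
    (T : (recordDomSys F Mc k K).Dom → Ψ → FluctIdx F k K → FluctIdx F k K → ℂ) (ψ : Ψ) (s : (Fin 4 → ℤ) → ℂ) (y : Fin 4 → ℤ) (i j : NonB0Idx F k K) :
    Differentiable ℂ (fun t : ℂ => piecesFormC F k K T (recordSWeight F Mc k K (update s y t)) ψ i j) := by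
  simp only [piecesFormC]
  exact Differentiable.fun_sum fun Y _ => (differentiable_recordSWeight_update F Mc k K s y Y).mul_const _

/-! ## §15  The docking theorems AT THE RECORD — what remains displayed is (F-coer), (F-int) and, for the bound, (F-im) -/

/-- ★★ **SEPARATE HOLOMORPHY OF THE RECORD FLUCTUATION RATIO off nothing** (`SepHolOff R []`), for `R < R'`, from: (F-coer) uniform real-part coercivity of the re-weighted precision on
`cpoly R'`; (F-int) the exponent socket `E g s ψ` measurable in `x` on `cpoly R'`, holomorphic along coordinate lines on `supp χ_rem`, `Re ≤ η` on `supp χ_rem` over `cpoly R'`.  The cut-off's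
measurability∕bound (§14) and (F-Mhol) (§14) are discharged HERE; the conclusion is the holomorphy input of ✓`norm_decDiffList_le_exp_of_le_length` for
`G := s ↦ recordFluctRatioC F Mc k K ε₁ T E g s ψ`. [cite: Balaban1987RG1, (2.12)–(2.13) p.268; Balaban1988RG2Cluster, (1.10)+(1.23) p.4–8 (locator); Brydges1986, Part III §2 (locator)] -/
theorem sepHolOff_recordFluctRatioC {Ψ : Type*} (Mc k K : ℕ) (ε₁ : ℝ)
    (T : (recordDomSys F Mc k K).Dom → Ψ → FluctIdx F k K → FluctIdx F k K → ℂ) (E : ℝ → ((Fin 4 → ℤ) → ℂ) → Ψ → (NonB0Idx F k K → ℝ) → ℂ) (g : ℝ) (ψ : Ψ)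
    {R R' : ℝ} (hRR' : R < R') {a : ℝ} (ha : 0 < a)
    (hcoer : ∀ s ∈ cpoly (ι := Fin 4 → ℤ) R', ∀ x : NonB0Idx F k K → ℝ, a * ∑ i, x i ^ 2 ≤ (quadC (piecesFormC F k K T (recordSWeight F Mc k K s) ψ) x).re)
    (hEm : ∀ s ∈ cpoly (ι := Fin 4 → ℤ) R', Measurable (E g s ψ))
    (hEh : ∀ s ∈ cpoly (ι := Fin 4 → ℤ) R, ∀ (y : Fin 4 → ℤ) (x : NonB0Idx F k K → ℝ), chiRem F k K ε₁ x ≠ 0 →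
      DifferentiableOn ℂ (fun t : ℂ => E g (update s y t) ψ x) (ball (0 : ℂ) R'))
    (η : ℝ) (hEre : ∀ s ∈ cpoly (ι := Fin 4 → ℤ) R', ∀ x, chiRem F k K ε₁ x ≠ 0 → (E g s ψ x).re ≤ η) :
    SepHolOff R [] (fun s => recordFluctRatioC F Mc k K ε₁ T E g s ψ) := by
  classical
  simp only [recordFluctRatioC_eq]
  exact sepHolOff_gaussRatioC hRR' (chiRem F k K ε₁) (measurable_chiRem F k K ε₁) (abs_chiRem_le_one F k K ε₁)
    (fun s => piecesFormC F k K T (recordSWeight F Mc k K s) ψ)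
    (fun s _ y i j => (differentiable_piecesFormC_recordSWeight_update F Mc k K T ψ s y i j).differentiableOn) ha hcoer
    (fun s => E g s ψ) hEm hEh η hEre

open Classical in
/-- ★★ **THE (1.18)-SHAPED BOUND ON THE CLOSED POLYDISC for the record fluctuation ratio**: (F-coer) on `cpoly R`, (F-int) `Re E ≤ η` on `supp χ_rem` over `cpoly R`, (F-im) the trace budget
`tr(S⁻¹B S⁻¹B) ≤ τ` for `S + iB := ½(M+Mᵀ)`, `M := piecesFormC F k K T (recordSWeight F Mc k K s) ψ`, over `cpoly R` ⟹ `BddOnPoly R (e^{η + τ∕4}) (s ↦ recordFluctRatioC F Mc k K ε₁ T E g s ψ)`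
— the bound input of ✓`norm_decDiffList_le_exp_of_le_length` (`0 ≤ χ_rem ≤ 1` discharged by ✓`chiRem_nonneg_le_one`). [cite: Balaban1988RG2Cluster, (1.18) p.7 (shape; locator); Brydges1986, Part III §2 (locator)] -/
theorem bddOnPoly_recordFluctRatioC {Ψ : Type*} (Mc k K : ℕ) (ε₁ : ℝ)
    (T : (recordDomSys F Mc k K).Dom → Ψ → FluctIdx F k K → FluctIdx F k K → ℂ) (E : ℝ → ((Fin 4 → ℤ) → ℂ) → Ψ → (NonB0Idx F k K → ℝ) → ℂ) (g : ℝ) (ψ : Ψ)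
    {R : ℝ} {a : ℝ} (ha : 0 < a) (η τ : ℝ)
    (hcoer : ∀ s ∈ cpoly (ι := Fin 4 → ℤ) R, ∀ x : NonB0Idx F k K → ℝ, a * ∑ i, x i ^ 2 ≤ (quadC (piecesFormC F k K T (recordSWeight F Mc k K s) ψ) x).re)
    (hEre : ∀ s ∈ cpoly (ι := Fin 4 → ℤ) R, ∀ x, chiRem F k K ε₁ x ≠ 0 → (E g s ψ x).re ≤ η)
    (htr : ∀ s ∈ cpoly (ι := Fin 4 → ℤ) R,
      (((gaussSymmPart (piecesFormC F k K T (recordSWeight F Mc k K s) ψ)).map Complex.re)⁻¹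
          * (gaussSymmPart (piecesFormC F k K T (recordSWeight F Mc k K s) ψ)).map Complex.im
          * ((gaussSymmPart (piecesFormC F k K T (recordSWeight F Mc k K s) ψ)).map Complex.re)⁻¹
          * (gaussSymmPart (piecesFormC F k K T (recordSWeight F Mc k K s) ψ)).map Complex.im).trace ≤ τ) :
    BddOnPoly R (Real.exp (η + (1 / 4 : ℝ) * τ)) (fun s => recordFluctRatioC F Mc k K ε₁ T E g s ψ) := by
  simp only [recordFluctRatioC_eq]
  exact bddOnPoly_gaussRatioC (chiRem F k K ε₁) (chiRem_nonneg_le_one F k K ε₁) (fun s => piecesFormC F k K T (recordSWeight F Mc k K s) ψ)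
    (fun s => E g s ψ) ha η τ hcoer hEre htr

/-! ## §16  The `|R − 1|` CLAUSE in coercive form and AT THE RECORD (✓ file №2 `norm_gaussRatioC_sub_one_le_box` with `PosDef`∕`IsSymm`∕integrability DISCHARGED) -/

section SubOne

variable {ι : Type*} [Fintype ι]

/-- Integrability of the numerator integrand from coercivity, measurability and the smallness `‖e^{E} − 1‖ ≤ η₁` on `supp χ` (dominator `(1+η₁)e^{−(a∕2)Σx²}`).
[cite: Balaban1987RG1, (2.12)+(2.19) p.268–270 (locator)] -/
theorem integrable_gaussIntC_integrand_of_coercive (χ : (ι → ℝ) → ℝ) (hχm : Measurable χ) (hχ : ∀ x, |χ x| ≤ 1) (M : Matrix ι ι ℂ) {a : ℝ} (ha : 0 < a)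
    (hcoer : ∀ x : ι → ℝ, a * ∑ i, x i ^ 2 ≤ (quadC M x).re) (E : (ι → ℝ) → ℂ) (hEm : Measurable E) {η₁ : ℝ} (hη₁ : 0 ≤ η₁)
    (hE : ∀ x, χ x ≠ 0 → ‖cexp (E x) - 1‖ ≤ η₁) :
    Integrable (fun x : ι → ℝ => (χ x : ℂ) * cexp (-(1 / 2 : ℂ) * quadC M x + E x)) := by
  refine Integrable.mono' ((integrable_exp_neg_mul_sum_sq_pi (half_pos ha)).const_mul (1 + η₁)) ?_ (Filter.Eventually.of_forall fun x => ?_)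
  · exact ((Complex.measurable_ofReal.comp hχm).mul ((((continuous_const.mul (continuous_quadC_real M)).measurable).add hEm).cexp)).aestronglyMeasurable
  · by_cases hx : χ x = 0
    · simp only [hx, Complex.ofReal_zero, zero_mul, norm_zero]; positivity
    · rw [norm_mul, Complex.norm_real, Real.norm_eq_abs, Complex.exp_add, norm_mul]
      have h1 : ‖cexp (-(1 / 2 : ℂ) * quadC M x)‖ ≤ Real.exp (-(a / 2) * ∑ i, x i ^ 2) := norm_cexp_neg_half_mul_le (hcoer x)
      have h2 : ‖cexp (E x)‖ ≤ 1 + η₁ :=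
        calc ‖cexp (E x)‖ = ‖(cexp (E x) - 1) + 1‖ := by rw [sub_add_cancel]
          _ ≤ ‖cexp (E x) - 1‖ + ‖(1 : ℂ)‖ := norm_add_le _ _
          _ ≤ η₁ + 1 := by rw [norm_one]; linarith [hE x hx]
          _ = 1 + η₁ := add_comm _ _
      calc |χ x| * (‖cexp (-(1 / 2 : ℂ) * quadC M x)‖ * ‖cexp (E x)‖)
          ≤ 1 * (Real.exp (-(a / 2) * ∑ i, x i ^ 2) * (1 + η₁)) :=
            mul_le_mul (hχ x) (mul_le_mul h1 h2 (norm_nonneg _) (Real.exp_pos _).le) (by positivity) zero_le_one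
        _ = (1 + η₁) * Real.exp (-(a / 2) * ∑ i, x i ^ 2) := by ring

/-- ★★ **THE `|R − 1|` CLAUSE, coercive form**: `‖gaussRatioC χ M E − 1‖ ≤ e^{¼tr(S⁻¹BS⁻¹B)}·(η₁ + 2Σ_i e^{−r²∕(2(S⁻¹)_{ii})})` for `S + iB := ½(M+Mᵀ)`, from coercivity `a·Σx² ≤ Re quadC M x`,
a measurable cut-off `0 ≤ χ ≤ 1` equal to `1` on the box `{|x_i| ≤ r}`, a measurable interaction with `‖e^{E} − 1‖ ≤ η₁` on `supp χ` — file №2's `norm_gaussRatioC_sub_one_le_box` with its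
`PosDef`∕`IsSymm`∕integrability hypotheses DISCHARGED (symmetrisation + §12 + the lemma above). [cite: Balaban1987RG1, (2.12)–(2.13)+(2.19) p.268–270 (locator); Brydges1986, Part III §2 (locator)] -/
theorem norm_gaussRatioC_sub_one_le_box_of_coercive [DecidableEq ι] (χ : (ι → ℝ) → ℝ) (hχm : Measurable χ) (hχ : ∀ x, 0 ≤ χ x ∧ χ x ≤ 1)
    (M : Matrix ι ι ℂ) {a : ℝ} (ha : 0 < a) (hcoer : ∀ x : ι → ℝ, a * ∑ i, x i ^ 2 ≤ (quadC M x).re)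
    (E : (ι → ℝ) → ℂ) (hEm : Measurable E) {η₁ r : ℝ} (hη₁ : 0 ≤ η₁) (hr : 0 ≤ r)
    (hχbox : ∀ x : ι → ℝ, (∀ i, |x i| ≤ r) → χ x = 1) (hE : ∀ x, χ x ≠ 0 → ‖cexp (E x) - 1‖ ≤ η₁) :
    ‖gaussRatioC χ M E - 1‖
      ≤ Real.exp ((1 / 4 : ℝ) * ((((gaussSymmPart M).map Complex.re)⁻¹ * (gaussSymmPart M).map Complex.im
            * ((gaussSymmPart M).map Complex.re)⁻¹ * (gaussSymmPart M).map Complex.im).trace))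
        * (η₁ + 2 * ∑ i, Real.exp (-(r ^ 2 / (2 * ((gaussSymmPart M).map Complex.re)⁻¹ i i)))) := by
  have hA := posDef_map_re_gaussSymmPart_of_coercive M ha hcoer
  have hχ' : ∀ x, |χ x| ≤ 1 := fun x => abs_le.mpr ⟨by linarith [(hχ x).1], (hχ x).2⟩
  have hcoer' : ∀ x : ι → ℝ, a * ∑ i, x i ^ 2 ≤ (quadC (gaussSymmPart M) x).re := fun x => by rw [quadC_gaussSymmPart]; exact hcoer x
  rw [← gaussRatioC_gaussSymmPart]
  refine norm_gaussRatioC_sub_one_le_box χ (gaussSymmPart M) E η₁ r hA (isSymm_gaussSymmPart_map_im M) hr hχ hχbox hη₁ hE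
    (integrable_gaussIntC_integrand_of_coercive χ hχm hχ' _ ha hcoer' E hEm hη₁ hE) ?_
  refine (integrable_gaussR_of_posDef _ hA).mono' ?_ (Filter.Eventually.of_forall fun x => ?_)
  · exact ((measurable_const.sub hχm).mul
      (Real.continuous_exp.comp (continuous_const.mul (continuous_quadFormR _))).measurable).aestronglyMeasurable
  · rw [norm_mul, Real.norm_eq_abs, Real.norm_eq_abs, abs_of_pos (Real.exp_pos _)]
    exact mul_le_of_le_one_left (Real.exp_pos _).le (abs_le.mpr ⟨by linarith [(hχ x).2], by linarith [(hχ x).1]⟩)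

end SubOne

/-- `χ_rem = 1` on the box `{|x_i| ≤ r}` as soon as `√3·r < ε₁` (three colour components per bond). [cite: Balaban1987RG1, (2.9) p.266 (bookkeeping)] -/
theorem chiRem_eq_one_of_box (k K : ℕ) {ε₁ r : ℝ} (hr : 0 ≤ r) (hrε : Real.sqrt 3 * r < ε₁) (x : NonB0Idx F k K → ℝ) (hx : ∀ i, |x i| ≤ r) :
    chiRem F k K ε₁ x = 1 := by
  classical
  unfold chiRem
  rw [if_pos]
  intro b hb
  have hle : ∑ a : Fin 3, x ⟨(b, a), hb⟩ ^ 2 ≤ 3 * r ^ 2 := by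
    calc ∑ a : Fin 3, x ⟨(b, a), hb⟩ ^ 2 ≤ ∑ _a : Fin 3, r ^ 2 := Finset.sum_le_sum fun a _ => by
            have := hx ⟨(b, a), hb⟩; rw [← sq_abs]; exact pow_le_pow_left₀ (abs_nonneg _) this 2
      _ = 3 * r ^ 2 := by simp
  calc √(∑ a : Fin 3, x ⟨(b, a), hb⟩ ^ 2) ≤ √(3 * r ^ 2) := Real.sqrt_le_sqrt hle
    _ = Real.sqrt 3 * r := by rw [Real.sqrt_mul (by norm_num : (0:ℝ) ≤ 3), Real.sqrt_sq hr]
    _ < ε₁ := hrε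

open Classical in
/-- ★★ **THE `|R − 1|` CLAUSE AT THE RECORD** (v13.3 chain (d), N3-input `|c| = 1`): for the record-pinned edition at a parameter point `s`, from (F-coer) at `s`, (F-int-small) `E g s ψ` measurable with
`‖e^{E} − 1‖ ≤ η₁` on `supp χ_rem`, and a box radius `0 ≤ r`, `√3·r < ε₁` ((F-tail-S) DISCHARGED by `chiRem_eq_one_of_box`):
`‖recordFluctRatioC … s ψ − 1‖ ≤ e^{¼tr(S⁻¹BS⁻¹B)}·(η₁ + 2Σ_i e^{−r²∕(2(S⁻¹)_{ii})})`. [cite: Balaban1987RG1, (2.12)–(2.13)+(2.19) p.268–270 (locator); Balaban1988RG2Cluster, (1.18) p.7 (shape)] -/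
theorem norm_recordFluctRatioC_sub_one_le {Ψ : Type*} (Mc k K : ℕ) (ε₁ : ℝ)
    (T : (recordDomSys F Mc k K).Dom → Ψ → FluctIdx F k K → FluctIdx F k K → ℂ) (E : ℝ → ((Fin 4 → ℤ) → ℂ) → Ψ → (NonB0Idx F k K → ℝ) → ℂ) (g : ℝ) (ψ : Ψ)
    (s : (Fin 4 → ℤ) → ℂ) {a : ℝ} (ha : 0 < a)
    (hcoer : ∀ x : NonB0Idx F k K → ℝ, a * ∑ i, x i ^ 2 ≤ (quadC (piecesFormC F k K T (recordSWeight F Mc k K s) ψ) x).re)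
    (hEm : Measurable (E g s ψ)) {η₁ r : ℝ} (hη₁ : 0 ≤ η₁) (hr : 0 ≤ r) (hrε : Real.sqrt 3 * r < ε₁)
    (hE : ∀ x, chiRem F k K ε₁ x ≠ 0 → ‖cexp (E g s ψ x) - 1‖ ≤ η₁) :
    ‖recordFluctRatioC F Mc k K ε₁ T E g s ψ - 1‖
      ≤ Real.exp ((1 / 4 : ℝ) * ((((gaussSymmPart (piecesFormC F k K T (recordSWeight F Mc k K s) ψ)).map Complex.re)⁻¹
            * (gaussSymmPart (piecesFormC F k K T (recordSWeight F Mc k K s) ψ)).map Complex.im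
            * ((gaussSymmPart (piecesFormC F k K T (recordSWeight F Mc k K s) ψ)).map Complex.re)⁻¹
            * (gaussSymmPart (piecesFormC F k K T (recordSWeight F Mc k K s) ψ)).map Complex.im).trace))
        * (η₁ + 2 * ∑ i, Real.exp (-(r ^ 2 / (2 * ((gaussSymmPart (piecesFormC F k K T (recordSWeight F Mc k K s) ψ)).map Complex.re)⁻¹ i i)))) := by
  rw [recordFluctRatioC_eq]
  exact norm_gaussRatioC_sub_one_le_box_of_coercive (chiRem F k K ε₁) (measurable_chiRem F k K ε₁) (chiRem_nonneg_le_one F k K ε₁) _ ha hcoer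
    _ hEm hη₁ hr (chiRem_eq_one_of_box F k K hr hrε) hE

/-! ## §17  END TO END: the (1.18)-shaped Cauchy rate for the record fluctuation ratio, modulo (F-coer)(F-int)(F-im) -/

/-- ★★★ **`‖Δ_{y₁}⋯Δ_{y_n} recordFluctRatioC (s)‖ ≤ e^{η + τ∕4}·e^{−κ₁ d}`** for `d ≤ n`, `s ∈ cpoly (1 + e^{κ₁})`, `κ₁ ≥ 0`, distinct `y`'s — ✓`norm_decDiffList_le_exp_of_le_length` (CauchyDecoupling :207)
FIRED on DEF-1's record fluctuation ratio with radius `R := 1 + e^{κ₁} < R'`, its two inputs supplied by §15.  DISPLAYED, and nothing else: (F-coer) on `cpoly R'`, (F-int) (measurable on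
`cpoly R'`; holomorphic along coordinate lines through `cpoly R` on `supp χ_rem`; `Re ≤ η` on `supp χ_rem` over `cpoly R'`), (F-im) the trace budget `τ` on `cpoly R`.
[cite: Balaban1988RG2Cluster, (1.8)–(1.10) p.3–5, (1.18) p.7, (2.30) p.18 (shape; locators); Brydges1986, Part III §2 (locator)] -/
theorem norm_decDiffList_recordFluctRatioC_le {Ψ : Type*} (Mc k K : ℕ) (ε₁ : ℝ)
    (T : (recordDomSys F Mc k K).Dom → Ψ → FluctIdx F k K → FluctIdx F k K → ℂ) (E : ℝ → ((Fin 4 → ℤ) → ℂ) → Ψ → (NonB0Idx F k K → ℝ) → ℂ) (g : ℝ) (ψ : Ψ)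
    {κ₁ R' a : ℝ} (hκ0 : 0 ≤ κ₁) (hR' : 1 + Real.exp κ₁ < R') (ha : 0 < a) (η τ : ℝ)
    (hcoer : ∀ s ∈ cpoly (ι := Fin 4 → ℤ) R', ∀ x : NonB0Idx F k K → ℝ, a * ∑ i, x i ^ 2 ≤ (quadC (piecesFormC F k K T (recordSWeight F Mc k K s) ψ) x).re)
    (hEm : ∀ s ∈ cpoly (ι := Fin 4 → ℤ) R', Measurable (E g s ψ))
    (hEh : ∀ s ∈ cpoly (ι := Fin 4 → ℤ) (1 + Real.exp κ₁), ∀ (y : Fin 4 → ℤ) (x : NonB0Idx F k K → ℝ), chiRem F k K ε₁ x ≠ 0 →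
      DifferentiableOn ℂ (fun t : ℂ => E g (update s y t) ψ x) (ball (0 : ℂ) R'))
    (hEre : ∀ s ∈ cpoly (ι := Fin 4 → ℤ) R', ∀ x, chiRem F k K ε₁ x ≠ 0 → (E g s ψ x).re ≤ η)
    (htr : ∀ s ∈ cpoly (ι := Fin 4 → ℤ) (1 + Real.exp κ₁),
      (((gaussSymmPart (piecesFormC F k K T (recordSWeight F Mc k K s) ψ)).map Complex.re)⁻¹
          * (gaussSymmPart (piecesFormC F k K T (recordSWeight F Mc k K s) ψ)).map Complex.im
          * ((gaussSymmPart (piecesFormC F k K T (recordSWeight F Mc k K s) ψ)).map Complex.re)⁻¹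
          * (gaussSymmPart (piecesFormC F k K T (recordSWeight F Mc k K s) ψ)).map Complex.im).trace ≤ τ)
    {l : List (Fin 4 → ℤ)} (hl : l.Nodup) {s : (Fin 4 → ℤ) → ℂ} (hs : s ∈ cpoly (ι := Fin 4 → ℤ) (1 + Real.exp κ₁)) {d : ℝ} (hd : d ≤ l.length) :
    ‖decDiffList l (fun s => recordFluctRatioC F Mc k K ε₁ T E g s ψ) s‖ ≤ Real.exp (η + (1 / 4 : ℝ) * τ) * Real.exp (-κ₁ * d) := by
  classical
  have hR : (1 : ℝ) < 1 + Real.exp κ₁ := by linarith [Real.exp_pos κ₁]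
  have hsub : cpoly (ι := Fin 4 → ℤ) (1 + Real.exp κ₁) ⊆ cpoly (ι := Fin 4 → ℤ) R' := cpoly_mono hR'.le
  exact norm_decDiffList_le_exp_of_le_length hR (by linarith) hκ0 (Real.exp_pos _).le
    (sepHolOff_recordFluctRatioC F Mc k K ε₁ T E g ψ hR' ha hcoer hEm hEh η hEre)
    (bddOnPoly_recordFluctRatioC F Mc k K ε₁ T E g ψ ha η τ (fun s hs => hcoer s (hsub hs)) (fun s hs => hEre s (hsub hs)) htr) hl hs hd

end Summit.QuantumFields.YangMills.Theorems.K0AxComplexGaussianRatio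

end
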